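import Summits.Parity.GeneralizedHardyLittlewood.Theorems.LiouvilleShiftedTablesEngineToPairsSieveFactors
import Summits.Parity.GeneralizedHardyLittlewood.Theorems.LiouvilleShiftedTablesEngineToPairsSieveDispatch
import Summits.Parity.GeneralizedHardyLittlewood.Theorems.LiouvilleShiftedTablesEngineToPairsSieveExponents

/-!
# Correlation sieve for line `Sketch` of the crux `EngineToPairs` (stmt-Parity-14659), part 6:
# a fully boxed tuple (at most one high smooth factor) is Type II or Type I

Support file for the stub `stub_sieve : CorrelationSieveFamily`.  Setting: `Large δ x`, a Heath-Brown piece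
`j ∈ {1,2,3}`, a set `L` of at most ONE smooth index carrying the high part of the split at `V = x^{9/20}`,
and a box-tuple `κ`; the boxed factors are `g_i = boxRestrict x 1 (κ i) (selF V U j L i)`.

* `corrFun_prod_units_le` — the factors whose box lies below `1` are units and may be discarded;
* `abs_prod_box_le` — a product of boxed factors over `S` is bounded by `log x · τ^{#S+?}` (`≤ log x · tauPow 6`);
* `tuple_bound_boxed` — for `#L ≤ 1`: `∑_q |corrFun (w q) x (∏_i g_i)| ≤ 4 (log x)² (TI + TII)` under the
  Type-I family hypothesis of level `x^{1/2−2δ}` and the Type-II family hypothesis on `[δ/2, 1/3+δ]`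
  (exponent trichotomy on the genuine boxes: window ⇒ `typeII_dispatch`; a smooth box `≥ x^{1/2+21δ/10}`
  ⇒ it is the `L`-factor ⇒ `typeI_dispatch_one/log`; two large smooth boxes contradict `#L ≤ 1`).
-/

noncomputable section

namespace Summit.Parity.GeneralizedHardyLittlewood.Theorems.EngineToPairs.Sieve

open Finset Real
open scoped ArithmeticFunction.zeta ArithmeticFunction.Moebius ArithmeticFunction.sigma
open Literature.NumberTheory.Sieve Literature.NumberTheory.Sieve.BFI

/-! ### Discarding the unit factors -/

/-- `corrFun w x 1 = 0` for `x ≥ 2` (the Dirichlet identity lives at `n = 1 ∉ (x/2, x]`). [folklore] -/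
theorem corrFun_one_eq_zero (w : ℕ → ℝ) {x : ℝ} (hx : 2 ≤ x) :
    corrFun w x (fun n => (1 : ArithmeticFunction ℝ) n) = 0 := by
  unfold corrFun
  refine Finset.sum_eq_zero fun n hn => ?_
  have h1 : 1 ≤ ⌊x / 2⌋₊ := Nat.le_floor (by norm_num; linarith)
  have hn1 : n ≠ 1 := by have := (Finset.mem_Ioc.1 hn).1; omega
  simp only [ArithmeticFunction.one_apply, hn1, if_false, zero_mul]

/-- **Discarding units.**  For boxed factors `g_i = boxRestrict x 1 (κ i) (F i)` with `|F i 1| ≤ 1`, the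
factors with box below `1` vanish off `{1}` and act as scalars of modulus `≤ 1`:
`∑_q |corrFun (w q) x (∏_i g_i)| ≤ ∑_q |corrFun (w q) x (∏_{i : 1 ≤ lo_i} g_i)|` (hypothesis: `|g_i(1)| ≤ 1`).
[this line] -/
theorem corrFun_prod_units_le {ι : Type*} [Fintype ι] [DecidableEq ι] (Qs : Finset ℕ) (w : ℕ → ℕ → ℝ)
    (x : ℝ) (κ : ι → ℕ) (F : ι → ArithmeticFunction ℝ) (hF1 : ∀ i, |boxRestrict x 1 (κ i) (F i) 1| ≤ 1) :
    ∑ q ∈ Qs, |corrFun (w q) x (fun n => (∏ i, boxRestrict x 1 (κ i) (F i)) n)| ≤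
      ∑ q ∈ Qs, |corrFun (w q) x (fun n =>
        (∏ i ∈ univ.filter (fun i => (1 : ℝ) ≤ boxLow x 1 (κ i)), boxRestrict x 1 (κ i) (F i)) n)| := by
  classical
  set Un := univ.filter (fun i : ι => ¬ (1 : ℝ) ≤ boxLow x 1 (κ i)) with hUn
  set Gen := univ.filter (fun i : ι => (1 : ℝ) ≤ boxLow x 1 (κ i)) with hGen
  set c : ℝ := ∏ i ∈ Un, boxRestrict x 1 (κ i) (F i) 1 with hc
  have hsplit : (∏ i, boxRestrict x 1 (κ i) (F i)) =
      (∏ i ∈ Un, boxRestrict x 1 (κ i) (F i)) * ∏ i ∈ Gen, boxRestrict x 1 (κ i) (F i) := by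
    rw [hUn, hGen, mul_comm, Finset.prod_filter_mul_prod_filter_not]
  have hunit : ∀ i ∈ Un, ∀ n, n ≠ 1 → boxRestrict x 1 (κ i) (F i) n = 0 := by
    intro i hi n hn
    have hlt : boxLow x 1 (κ i) < 1 := not_le.1 (Finset.mem_filter.1 hi).2
    exact box_eq_zero_of_boxLow_lt_one hlt (F i) hn
  have hc1 : |c| ≤ 1 := by
    rw [hc, Finset.abs_prod]
    exact Finset.prod_le_one (fun i _ => abs_nonneg _) fun i _ => hF1 i
  refine Finset.sum_le_sum fun q _ => ?_
  have heq : corrFun (w q) x (fun n => (∏ i, boxRestrict x 1 (κ i) (F i)) n) =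
      c * corrFun (w q) x (fun n => (∏ i ∈ Gen, boxRestrict x 1 (κ i) (F i)) n) := by
    rw [← corrFun_smul]
    refine corrFun_congr fun n _ => ?_
    rw [hsplit, prod_mul_apply_of_support_one Un _ hunit]
  rw [heq, abs_mul]
  exact mul_le_of_le_one_left (abs_nonneg _) hc1

/-! ### Coefficient bounds for products of boxed factors -/

section Setup

variable {δ x : ℝ} (hLx : Large δ x) {U j : ℕ} (hj : 1 ≤ j) (L : Finset (Fin (2 * j))) (κ : Fin (2 * j) → ℕ)

/-- The boxed selected factor. [this line] -/
def gF (x : ℝ) (U j : ℕ) (L : Finset (Fin (2 * j))) (κ : Fin (2 * j) → ℕ) (i : Fin (2 * j)) :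
    ArithmeticFunction ℝ :=
  boxRestrict x 1 (κ i) (selF (x ^ ((9 : ℝ) / 20)) U j L i)

include hLx hj in
/-- Pointwise bound of a boxed factor: `≤ 1` for the non-`log` factors, `≤ log x` for the `log` factor
(which lives in a box `⊆ [1, x]`). [this line] -/
theorem abs_gF_le (i : Fin (2 * j)) (n : ℕ) :
    |gF x U j L κ i n| ≤ if i.val = 2 * j - 1 then Real.log x else 1 := by
  unfold gF
  split_ifs with hi
  · rw [boxRestrict_apply]
    split_ifs with hin
    · refine (abs_selF_log_le _ hj L hi n).trans ?_
      have hn0 : (0 : ℝ) < n := by exact_mod_cast hin.1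
      exact Real.log_le_log hn0 (hin.2.2.trans (boxHigh_le hLx.pos.le _))
    · rw [abs_zero]; exact hLx.log_pos.le
  · exact (abs_box_le x (κ i) _ n).trans (abs_selF_le_one _ L hi n)

include hLx hj in
/-- **Coefficient bound**: for `S` with `#S ≤ 6`, `|(∏_{i∈S} g_i)(m)| ≤ log x · tauPow 6 m`. [this line] -/
theorem abs_prod_gF_le (S : Finset (Fin (2 * j))) (hS : S.card ≤ 6) (m : ℕ) :
    |(∏ i ∈ S, gF x U j L κ i) m| ≤ Real.log x * tauPow 6 m := by
  classical
  have hlog1 : 1 ≤ Real.log x := hLx.one_le_log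
  rcases S.eq_empty_or_nonempty with rfl | hne
  · rw [Finset.prod_empty, ArithmeticFunction.one_apply]
    split_ifs with hm
    · subst hm
      rw [abs_one, tauPow]
      simp only [Nat.divisors_one, Finset.card_singleton, Nat.cast_one, one_pow, mul_one]
      exact hlog1
    · rw [abs_zero]; exact mul_nonneg hLx.log_pos.le (tauPow_nonneg 6 m)
  rcases Nat.eq_zero_or_pos m with rfl | hm
  · simp only [ArithmeticFunction.map_zero, abs_zero]
    exact mul_nonneg hLx.log_pos.le (tauPow_nonneg 6 0)
  set A : Fin (2 * j) → ℝ := fun i => if i.val = 2 * j - 1 then Real.log x else 1 with hA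
  have hA1 : ∀ i ∈ S, 1 ≤ A i := fun i _ => by simp only [hA]; split_ifs <;> [exact hlog1; exact le_rfl]
  have h1 := abs_prod_apply_le_of_abs_le S (gF x U j L κ) A hA1 (fun i _ n => abs_gF_le hLx hj L κ i n) m
  -- `∏ A ≤ log x` (at most one `log` factor) and `τ^{#S} ≤ τ^6`
  have hprodA : ∏ i ∈ S, A i ≤ Real.log x := by
    have hsub : ∀ i ∈ S, A i ≤ (if i.val = 2 * j - 1 then Real.log x else 1) := fun i _ => le_rfl
    by_cases hmem : ∃ i ∈ S, i.val = 2 * j - 1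
    · obtain ⟨i₀, hi₀, hi₀v⟩ := hmem
      rw [← Finset.mul_prod_erase S A hi₀]
      have hrest : ∏ i ∈ S.erase i₀, A i = 1 := by
        refine Finset.prod_eq_one fun i hi => ?_
        have hne : i ≠ i₀ := Finset.ne_of_mem_erase hi
        have : i.val ≠ 2 * j - 1 := fun h => hne (Fin.ext (by rw [h, hi₀v]))
        simp [hA, this]
      rw [hrest, mul_one]
      simp [hA, hi₀v]
    · push Not at hmem
      rw [Finset.prod_eq_one (fun i hi => by simp [hA, hmem i hi])]
      exact hlog1
  have hτ : ((σ 0 m : ℕ) : ℝ) ^ S.card ≤ tauPow 6 m := by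
    rw [sigma_zero_pow_eq_tauPow]
    exact tauPow_le_tauPow hS (Finset.card_pos.2 hne) m
  have hτ0 : 0 ≤ ((σ 0 m : ℕ) : ℝ) ^ S.card := by positivity
  calc |(∏ i ∈ S, gF x U j L κ i) m| ≤ (∏ i ∈ S, A i) * ((σ 0 m : ℕ) : ℝ) ^ S.card := h1
    _ ≤ Real.log x * tauPow 6 m :=
        mul_le_mul hprodA hτ hτ0 hLx.log_pos.le

/-- Support of a boxed factor in terms of `lo = boxLow`: `g_i(d) ≠ 0 → lo_i < d ≤ 2 lo_i`. [folklore] -/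
theorem gF_support {i : Fin (2 * j)} {d : ℕ} (h : gF x U j L κ i d ≠ 0) :
    boxLow x 1 (κ i) < d ∧ (d : ℝ) ≤ 2 * boxLow x 1 (κ i) := by
  obtain ⟨h1, h2, -⟩ := inBox_of_box_ne_zero h
  rw [boxHigh_eq_two_mul_boxLow] at h2
  exact ⟨h1, h2⟩

/-- Support of a product of boxed factors over a nonempty `S`: `(∏ lo, 2^{#S} ∏ lo]`. [folklore] -/
theorem prod_gF_support (hx : 0 < x) {S : Finset (Fin (2 * j))} (hS : S.Nonempty) {m : ℕ}
    (h : (∏ i ∈ S, gF x U j L κ i) m ≠ 0) :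
    (∏ i ∈ S, boxLow x 1 (κ i)) < m ∧ (m : ℝ) ≤ 2 ^ S.card * ∏ i ∈ S, boxLow x 1 (κ i) :=
  prod_apply_ne_zero_box hS (fun i _ => (boxLow_pos hx (by norm_num) (κ i)).le)
    (fun i _ d hd => gF_support L κ hd) h

end Setup

end Summit.Parity.GeneralizedHardyLittlewood.Theorems.EngineToPairs.Sieve

namespace Summit.Parity.GeneralizedHardyLittlewood.Theorems.EngineToPairs

/-- Registered sub-goal of `stub_sieve` carried by this part (landing mechanics): the Dirichlet identity
contributes nothing to the functional on `(x/2, x]`, `x ≥ 2`. [folklore] -/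
theorem sieve_part6a_anchor : ∀ (w : ℕ → ℝ) (x : ℝ), 2 ≤ x → Summit.Parity.GeneralizedHardyLittlewood.Theorems.EngineToPairs.Sieve.corrFun w x (fun n => (1 : ArithmeticFunction ℝ) n) = 0 :=
  fun w _ hx => Sieve.corrFun_one_eq_zero w hx

end Summit.Parity.GeneralizedHardyLittlewood.Theorems.EngineToPairs

end
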